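import Summits.CriticalPhenomena.PercolationContinuityZ3.Theorems.Transplant.PlanarSkeletonFrmQuasiDefs
import Summits.CriticalPhenomena.PercolationContinuityZ3.Theorems.Transplant.SkelFrmQuasiBChoiceWindow3
import Summits.CriticalPhenomena.PercolationContinuityZ3.Theorems.Transplant.SkelFrmBChoiceWindow3
import Summits.CriticalPhenomena.PercolationContinuityZ3.Theorems.Transplant.SkelFrmFromBChoiceCreep
import Summits.CriticalPhenomena.PercolationContinuityZ3.Theorems.Transplant.SkelFrmBChoiceCreep
import Summits.CriticalPhenomena.PercolationContinuityZ3.Theorems.Transplant.SkelFrmBChoiceCreepYCore3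
import Summits.CriticalPhenomena.PercolationContinuityZ3.Theorems.Transplant.SkelFrmQuasiBChoiceCreepY
import Summits.CriticalPhenomena.PercolationContinuityZ3.Theorems.Transplant.SkelFrmBChoiceCreepY
import Summits.CriticalPhenomena.PercolationContinuityZ3.Theorems.Transplant.SkelFrmBChoiceCreepYCore
import Summits.CriticalPhenomena.PercolationContinuityZ3.Theorems.Transplant.SkelFrmQuasi1ChoiceDefs
import Summits.CriticalPhenomena.PercolationContinuityZ3.Theorems.Transplant.SkelFrmQuasi1ParamsLBL
import Summits.CriticalPhenomena.PercolationContinuityZ3.Theorems.Transplant.SkelFrmQuasi1ParamsPO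
import Summits.CriticalPhenomena.PercolationContinuityZ3.Theorems.Transplant.SkelFrmQuasiBChoiceReadNums
import Summits.CriticalPhenomena.PercolationContinuityZ3.Theorems.Transplant.SkelFrmQuasiBChoiceReadings
import Summits.CriticalPhenomena.PercolationContinuityZ3.Theorems.Transplant.SkelFrmQuasiBChoiceWindow
import Summits.CriticalPhenomena.PercolationContinuityZ3.Theorems.Transplant.SkelFrmQuasiBChoiceWindowY2
import Summits.CriticalPhenomena.PercolationContinuityZ3.Theorems.Transplant.SkelFrmQuasiBParamsCorrKG
import Summits.CriticalPhenomena.PercolationContinuityZ3.Theorems.Transplant.SkelFrmQuasiBParamsCorrKG0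
import Summits.CriticalPhenomena.PercolationContinuityZ3.Theorems.Transplant.SkelFrmQuasiBParamsCorrKGLen3
import Summits.CriticalPhenomena.PercolationContinuityZ3.Theorems.Transplant.SkelFrmQuasiBParamsCorrKGLenY
import Summits.CriticalPhenomena.PercolationContinuityZ3.Theorems.Transplant.SkelFrmQuasiBParamsCorrKGY
import Summits.CriticalPhenomena.PercolationContinuityZ3.Theorems.Transplant.SkelFrmQuasiBParamsLF
import Summits.CriticalPhenomena.PercolationContinuityZ3.Theorems.Transplant.SkelFrmQuasiBParamsLFA
import Summits.CriticalPhenomena.PercolationContinuityZ3.Theorems.Transplant.SkelFrmQuasiBParamsSchedA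
import Summits.CriticalPhenomena.PercolationContinuityZ3.Theorems.Transplant.SkelFrmQuasi1SlotTypes
import Summits.CriticalPhenomena.PercolationContinuityZ3.Theorems.Transplant.SkelFrmQuasiBChoiceNums
import HarnessLib
import Summits.CriticalPhenomena.PercolationContinuityZ3.Theorems.Transplant.SkelFrmBChoiceCreepY3
/-!
# GEN-Q PORT (WAVE-Q table v0.8 section 2, row G125, U-level L?; captain R-6/R-7 2026-08-27: carrier token swap `PlanarSkeletonFrmFrom ↦ PlanarSkeletonFrmQuasi`)
# of the tree module «Transplant/SkelFrmFromBChoiceCreepY3» (sha256 45c512d85234c221…) onto the quasi-step carrier `PlanarSkeletonFrmQuasi` (p507026): «SkelFrmQuasiBChoiceCreepY3»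

ORIGINAL TITLE: N2 (frames-only node `SamePDropOfSkeletonFrm₁`, OPEN) — (ζ″) at the (R-45) instance of record `BSlot.small3 = (76·s₀, 19·s₁)` (lead g12 14:36/14:46

builds on p205010 (kernel theorem, internal audit signed; external expert review pending) — nothing in this file uses p205010; NOTHING is claimed about any open node
((N3-b), the end state).  Lane `prim-bschramm`, seat `prim-bschramm-gen-1` (gen 5; WAVE-Q captain).  Helper file (`--supports stmt-CriticalPhenomena-4575 --as helper`).
PORT RULES (U-wave r1–r4 re-used, GEN-Q hunk classes of p3-g29 #6136): declaration order, names and proof texts are those of «SkelFrmFromBChoiceCreepY3», byte-identical except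
(i) the carrier token `PlanarSkeletonFrmFrom ↦ PlanarSkeletonFrmQuasi` in binders, `namespace`/`end` lines and qualified names (module names `SkelFrmFrom… ↦ SkelFrmQuasi…`
in imports of already-ported rows); (ii) `Φ.step ↦ Φ.qstep` with the called Steps lemma replaced by its `…Q`/`_q` twin and the cost `Φ.M` threaded (none in this file unless
listed below); (iii) `Φ.cyl_connected ↦ Φ.cyl_reach` readers (none unless listed); (iv) graph-ball radii / window floors ×`Φ.M` (none unless listed); (v) KS0 READER HUNK of record (L-KitS-1 / L-FLOORMAP-1 ①, stmt-g33's table #6324, tool T6): the (S0) kit data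
of «SkelFrmQuasiBChoiceNums» (G017) are N-parametrised and read at `N := KS.NQ Φ = 13·max Φ.M 1` — IN THIS FILE KS0.R'0N ×11 (e.g. `KS0.R'0 κ Φ … ↦ KS0.R'0N κ Φ (KS.NQ Φ) …`), nothing else.  Carrier-free
residents stay imported/exported from the original «SkelFrmBChoiceCreepY3» exactly as in the FrmFrom port.  Docstrings and citations are the original's.
Row G125 (gen-1 g5, captain R-19).
-/

open scoped Classical

noncomputable section

namespace Summit.CriticalPhenomena.PercolationContinuityZ3.Theorems.Transplant

namespace PlanarSkeletonFrmQuasi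

export PlanarSkeletonNeg.NegB (Aof)  -- T3-auto: resident alias(es) replicated from the FrmFrom namespace
export PlanarSkeletonNeg.Neg (K K_eq Kq)  -- T3-auto: resident alias(es) replicated from the FrmFrom namespace
export PlanarSkeletonFrmFrom.NegB (hLl_Q)  -- T3-auto: resident alias(es) replicated from the FrmFrom namespace
export PlanarSkeletonFrm.NegB (kgSLY_eq_kgSL)  -- T3-auto: resident alias(es) replicated from the FrmFrom namespace

open PlanarSkeletonFrm.NegB (creepY_core3 floorA_bounds)

namespace NegB

open Literature.Probability.Percolation Literature.Probability.LatticeModels SimpleGraph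
open Literature.Probability.Percolation.KozmaNitzan.Cells (oth)
open SkelConc (Consts)
open Skelφ (shearUnit kgSL kgSLY kgM₁Y kgM₂Y kgE₁Y kgXY kgCtr2Y kgHw2Y kgA₁Yp kgT₁Y kgTY kgDec₁Y kgDec₂Y dS rdLo rdHi KGYRows)
open TwoAxis.Para (modulus)
open Neg

section CreepY

variable (κ : Consts) {V : Type} [DecidableEq V] [Countable V] {G : SimpleGraph V} [G.LocallyFinite] (Φ : PlanarSkeletonFrmQuasi G) (t : V) (p : unitInterval)
  (D : Skelφ.StepI.DataNS V) (g f mk : ℕ)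

/-! ## §1 The y′-arrival box at the tuple of record and the tuple's numbers -/

/-- The y′-arrival box's lower corner at the tuple of record (`= KGYRows.kgLastLoY` at `ρ := 0`, `q := kgqY qxYQ4`, `W := kgWY WxYQ4`, `N := kgNYv0`). [this work] -/
def arrLoY3 (κ : Consts) {V : Type} [DecidableEq V] [Countable V] {G : SimpleGraph V} [G.LocallyFinite] (Φ : PlanarSkeletonFrmQuasi G) (t : V) (p : unitInterval) (D : Skelφ.StepI.DataNS V) (g : ℕ) (f : ℕ) (mk : ℕ) : Site 2 :=
  ![(kgCtr2Y (nL κ Φ t p D g f) (vL κ Φ t p D g f) (kgR κ Φ t p D mk) 0 (kgWY κ Φ t p D g f (WxYQ4 κ Φ t p D g f)) (kgNYv0 κ Φ t p D g f mk (qxYQ4 κ Φ t p D g f) (WxYQ4 κ Φ t p D g f)) -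
      kgHw2Y (nL κ Φ t p D g f) (ℓL κ Φ t p D g f) (hL κ Φ t p D g f) (vL κ Φ t p D g f) (kgR κ Φ t p D mk) 0 (kgqY κ Φ t p D g f (qxYQ4 κ Φ t p D g f))
        (kgWY κ Φ t p D g f (WxYQ4 κ Φ t p D g f)) (kgNYv0 κ Φ t p D g f mk (qxYQ4 κ Φ t p D g f) (WxYQ4 κ Φ t p D g f)) + 1) / 2,
    (((kgNYv0 κ Φ t p D g f mk (qxYQ4 κ Φ t p D g f) (WxYQ4 κ Φ t p D g f) : ℕ) : ℤ) + 1) * kgSLY (nL κ Φ t p D g f) (ℓL κ Φ t p D g f) (hL κ Φ t p D g f) +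
      kgXY (nL κ Φ t p D g f) (ℓL κ Φ t p D g f) (hL κ Φ t p D g f) (vL κ Φ t p D g f) (kgR κ Φ t p D mk) 0 (kgqY κ Φ t p D g f (qxYQ4 κ Φ t p D g f))
        (kgWY κ Φ t p D g f (WxYQ4 κ Φ t p D g f)) (kgNYv0 κ Φ t p D g f mk (qxYQ4 κ Φ t p D g f) (WxYQ4 κ Φ t p D g f)) -
      ((nL κ Φ t p D g f : ℤ) * ℓL κ Φ t p D g f / (shearUnit (nL κ Φ t p D g f) (hL κ Φ t p D g f) : ℕ) + 1 + ((0 : ℕ) : ℤ) - 1)]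

/-- The y′-arrival box's upper corner at the tuple of record (`= KGYRows.kgLastHiY`). [this work] -/
def arrHiY3 (κ : Consts) {V : Type} [DecidableEq V] [Countable V] {G : SimpleGraph V} [G.LocallyFinite] (Φ : PlanarSkeletonFrmQuasi G) (t : V) (p : unitInterval) (D : Skelφ.StepI.DataNS V) (g : ℕ) (f : ℕ) (mk : ℕ) : Site 2 :=
  ![(kgCtr2Y (nL κ Φ t p D g f) (vL κ Φ t p D g f) (kgR κ Φ t p D mk) 0 (kgWY κ Φ t p D g f (WxYQ4 κ Φ t p D g f)) (kgNYv0 κ Φ t p D g f mk (qxYQ4 κ Φ t p D g f) (WxYQ4 κ Φ t p D g f)) +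
      kgHw2Y (nL κ Φ t p D g f) (ℓL κ Φ t p D g f) (hL κ Φ t p D g f) (vL κ Φ t p D g f) (kgR κ Φ t p D mk) 0 (kgqY κ Φ t p D g f (qxYQ4 κ Φ t p D g f))
        (kgWY κ Φ t p D g f (WxYQ4 κ Φ t p D g f)) (kgNYv0 κ Φ t p D g f mk (qxYQ4 κ Φ t p D g f) (WxYQ4 κ Φ t p D g f))) / 2,
    (((kgNYv0 κ Φ t p D g f mk (qxYQ4 κ Φ t p D g f) (WxYQ4 κ Φ t p D g f) : ℕ) : ℤ) + 1) * kgSLY (nL κ Φ t p D g f) (ℓL κ Φ t p D g f) (hL κ Φ t p D g f) +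
      kgXY (nL κ Φ t p D g f) (ℓL κ Φ t p D g f) (hL κ Φ t p D g f) (vL κ Φ t p D g f) (kgR κ Φ t p D mk) 0 (kgqY κ Φ t p D g f (qxYQ4 κ Φ t p D g f))
        (kgWY κ Φ t p D g f (WxYQ4 κ Φ t p D g f)) (kgNYv0 κ Φ t p D g f mk (qxYQ4 κ Φ t p D g f) (WxYQ4 κ Φ t p D g f))]

/- The tuple's atoms as hygiene-free local notations (they expand syntactically at each use; importers see the expanded terms). -/
set_option hygiene false in local notation "NYᵣ" => kgNYv0 κ Φ t p D g f mk (qxYQ4 κ Φ t p D g f) (WxYQ4 κ Φ t p D g f)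
set_option hygiene false in local notation "qYᵣ" => kgqY κ Φ t p D g f (qxYQ4 κ Φ t p D g f)
set_option hygiene false in local notation "WYᵣ" => kgWY κ Φ t p D g f (WxYQ4 κ Φ t p D g f)
set_option hygiene false in local notation "Rᵣ" => kgR κ Φ t p D mk
set_option hygiene false in local notation "nᵣ" => nL κ Φ t p D g f
set_option hygiene false in local notation "ℓᵣ" => ℓL κ Φ t p D g f
set_option hygiene false in local notation "hᵣ" => hL κ Φ t p D g f
set_option hygiene false in local notation "vᵣ" => vL κ Φ t p D g f
set_option hygiene false in local notation "Uᵣ" => shearUnit (nL κ Φ t p D g f) (hL κ Φ t p D g f)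
set_option hygiene false in local notation "Δᵣ" => modulus (nL κ Φ t p D g f) (hL κ Φ t p D g f) (vL κ Φ t p D g f) (vβL κ Φ t p D g f)
set_option hygiene false in local notation "sLᵣ" => kgSL (nL κ Φ t p D g f) (ℓL κ Φ t p D g f) (hL κ Φ t p D g f)
set_option hygiene false in local notation "s0ᵣ" => (((fcellsA κ Φ t p D g f).s 0 : ℕ) : ℤ)
set_option hygiene false in local notation "r0ᵣ" => (((fcellsA κ Φ t p D g f).r 0 : ℕ) : ℤ)
set_option hygiene false in local notation "Kᵣ" => ((Neg.K κ : ℕ) : ℤ)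
set_option hygiene false in local notation "LOᵣ" => rdLo (Aof κ) (nL κ Φ t p D g f) (hL κ Φ t p D g f) (vL κ Φ t p D g f) (vβL κ Φ t p D g f) (prFA κ Φ t p D g f).c₀ (prFA κ Φ t p D g f).c₁ (prFA κ Φ t p D g f).D (arrLoY3 κ Φ t p D g f mk) (arrHiY3 κ Φ t p D g f mk) 0
set_option hygiene false in local notation "HIᵣ" => rdHi (Aof κ) (nL κ Φ t p D g f) (hL κ Φ t p D g f) (vL κ Φ t p D g f) (vβL κ Φ t p D g f) (prFA κ Φ t p D g f).c₀ (prFA κ Φ t p D g f).c₁ (prFA κ Φ t p D g f).D (arrLoY3 κ Φ t p D g f mk) (arrHiY3 κ Φ t p D g f mk) 0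

-- GEN-Q (R-2, captain 2026-08-27): `PlanarSkeletonFrmFrom.NegB.arrY3_eq` is not in the used cone of the node top — not ported.

/-- The box's coordinates by `rfl`. [folklore] -/
theorem arrY3_apply (κ : Consts) {V : Type} [DecidableEq V] [Countable V] {G : SimpleGraph V} [G.LocallyFinite] (Φ : PlanarSkeletonFrmQuasi G) (t : V) (p : unitInterval) (D : Skelφ.StepI.DataNS V) (g : ℕ) (f : ℕ) (mk : ℕ) :
    arrLoY3 κ Φ t p D g f mk 0 = (kgCtr2Y nᵣ vᵣ Rᵣ 0 WYᵣ NYᵣ - kgHw2Y nᵣ ℓᵣ hᵣ vᵣ Rᵣ 0 qYᵣ WYᵣ NYᵣ + 1) / 2 ∧ arrHiY3 κ Φ t p D g f mk 0 = (kgCtr2Y nᵣ vᵣ Rᵣ 0 WYᵣ NYᵣ + kgHw2Y nᵣ ℓᵣ hᵣ vᵣ Rᵣ 0 qYᵣ WYᵣ NYᵣ) / 2 ∧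
      arrLoY3 κ Φ t p D g f mk 1 = (((NYᵣ : ℕ) : ℤ) + 1) * kgSLY nᵣ ℓᵣ hᵣ + kgXY nᵣ ℓᵣ hᵣ vᵣ Rᵣ 0 qYᵣ WYᵣ NYᵣ - (((nᵣ : ℕ) : ℤ) * ℓᵣ / (Uᵣ : ℕ) + 1 + ((0 : ℕ) : ℤ) - 1) ∧
      arrHiY3 κ Φ t p D g f mk 1 = (((NYᵣ : ℕ) : ℤ) + 1) * kgSLY nᵣ ℓᵣ hᵣ + kgXY nᵣ ℓᵣ hᵣ vᵣ Rᵣ 0 qYᵣ WYᵣ NYᵣ :=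
  ⟨rfl, rfl, rfl, rfl⟩

/-- `W_Y = 2n + 96n = 98·n_L`. [folklore] -/
theorem WY_eq_3 (κ : Consts) {V : Type} [DecidableEq V] [Countable V] {G : SimpleGraph V} [G.LocallyFinite] (Φ : PlanarSkeletonFrmQuasi G) (t : V) (p : unitInterval) (D : Skelφ.StepI.DataNS V) (g : ℕ) (f : ℕ) : ((WYᵣ : ℕ) : ℤ) = 98 * ((nᵣ : ℕ) : ℤ) := by
  simp only [kgWY, WxYQ4]; push_cast; ring

/-- **`m₁Y + 1 ∈ [194, 198]`**: `T₁ = 196n + 2(N+1)R′ − 2|v| ∈ [194·dec₁, 199·dec₁)` under `40K·R′ + 1 ≤ n`, `K ≥ 80`. [this work] -/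
theorem a1Y_bounds_3 (κ : Consts) {V : Type} [DecidableEq V] [Countable V] {G : SimpleGraph V} [G.LocallyFinite] (Φ : PlanarSkeletonFrmQuasi G) (t : V) (p : unitInterval) (D : Skelφ.StepI.DataNS V) (g : ℕ) (f : ℕ) (mk : ℕ) (hKq : 5 ≤ Neg.Kq κ) (hN : EqNumL κ Φ t p D g f) (hg : gFloorKG κ Φ t p D mk ≤ g) (hg2 : 40 * Neg.K κ * KS0.R'0N κ Φ (KS.NQ Φ) t p D mk ≤ g) (N : ℕ)
    (hNle : ((N : ℕ) : ℤ) ≤ 21 * Kᵣ + 2) :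
    194 ≤ (((kgM₁Y nᵣ vᵣ Rᵣ 0 WYᵣ N : ℕ) : ℤ) + 1) ∧ (((kgM₁Y nᵣ vᵣ Rᵣ 0 WYᵣ N : ℕ) : ℤ) + 1) ≤ 198 := by
  obtain ⟨hnR', -, -, hR1, -, -⟩ := valsQ_floor κ Φ t p D g f mk hN hg hg2
  have H := kgYRows0_of κ Φ t p D g f mk (qxYQ4 κ Φ t p D g f) (WxYQ4 κ Φ t p D g f) hN hg
  obtain ⟨ha1eq, -⟩ := H.kgM₁Y_spec N
  have hv := hN.v_le
  have hd1eq := (dec₁Y_eq_Q κ Φ t p D g f mk).1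
  have hWY := WY_eq_3 κ Φ t p D g f
  have h80 : 80 ≤ Neg.K κ := by have := Neg.K_eq κ; omega
  have hK80 : (80 : ℤ) ≤ Kᵣ := by exact_mod_cast h80
  have hRR : ((KS0.R'0N κ Φ (KS.NQ Φ) t p D mk : ℕ) : ℤ) = ((Rᵣ : ℕ) : ℤ) := rfl
  rw [hRR] at hnR' hR1
  have hR0 : (0 : ℤ) ≤ ((Rᵣ : ℕ) : ℤ) := by linarith
  have hKR80 : 80 * ((Rᵣ : ℕ) : ℤ) ≤ Kᵣ * ((Rᵣ : ℕ) : ℤ) := mul_le_mul_of_nonneg_right hK80 hR0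
  have hd1pos : 0 < kgDec₁Y nᵣ Rᵣ 0 := by rw [hd1eq]; linarith
  have hNR : (((N : ℕ) : ℤ) + 1) * ((Rᵣ : ℕ) : ℤ) ≤ (21 * Kᵣ + 3) * ((Rᵣ : ℕ) : ℤ) := mul_le_mul_of_nonneg_right (by linarith) hR0
  have hN0 : (0 : ℤ) ≤ (((N : ℕ) : ℤ) + 1) * ((Rᵣ : ℕ) : ℤ) := by positivity
  have hva := abs_nonneg vᵣ
  constructor
  · rw [ha1eq, Int.le_ediv_iff_mul_le hd1pos]
    unfold Skelφ.kgT₁Y; rw [hWY, hd1eq]; linarith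
  · have hlt : (((kgM₁Y nᵣ vᵣ Rᵣ 0 WYᵣ N : ℕ) : ℤ) + 1) < 199 := by
      rw [ha1eq, Int.ediv_lt_iff_lt_mul hd1pos]
      unfold Skelφ.kgT₁Y; rw [hWY, hd1eq]; linarith
    linarith

/-- **`m₂Y + 1 ≤ 42`** (second-axis budget `kgM₂Y_budget` with `q = P + 19sL + 20`, `40K·R′ ≤ sL + 1`, `K ≥ 80`, `sL ≥ 958`). [this work] -/
theorem a2Y_le_3 (κ : Consts) {V : Type} [DecidableEq V] [Countable V] {G : SimpleGraph V} [G.LocallyFinite] (Φ : PlanarSkeletonFrmQuasi G) (t : V) (p : unitInterval) (D : Skelφ.StepI.DataNS V) (g : ℕ) (f : ℕ) (mk : ℕ) (hKq : 5 ≤ Neg.Kq κ) (hN : EqNumL κ Φ t p D g f) (hg : gFloorKG κ Φ t p D mk ≤ g) (hg2 : 40 * Neg.K κ * KS0.R'0N κ Φ (KS.NQ Φ) t p D mk ≤ g) (N : ℕ)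
    (hNle : ((N : ℕ) : ℤ) ≤ 21 * Kᵣ + 2) :
    1 ≤ (((kgM₂Y nᵣ ℓᵣ hᵣ vᵣ Rᵣ 0 qYᵣ WYᵣ N : ℕ) : ℤ) + 1) ∧ (((kgM₂Y nᵣ ℓᵣ hᵣ vᵣ Rᵣ 0 qYᵣ WYᵣ N : ℕ) : ℤ) + 1) ≤ 42 := by
  refine ⟨by have := Nat.cast_nonneg (α := ℤ) (kgM₂Y nᵣ ℓᵣ hᵣ vᵣ Rᵣ 0 qYᵣ WYᵣ N); linarith, ?_⟩
  obtain ⟨hnR', hs40, hbig, hR1, -, -⟩ := valsQ_floor κ Φ t p D g f mk hN hg hg2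
  obtain ⟨hn1, -⟩ := one_le_of_eqNumL κ Φ t p D g f hN
  have H := kgYRows0_of κ Φ t p D g f mk (qxYQ4 κ Φ t p D g f) (WxYQ4 κ Φ t p D g f) hN hg
  have hT0 := H.kgTY_sub_nonneg (kgY_floors κ Φ t p D g f mk hN hg).2.2.2.2 N
  have ha2b := H.kgM₂Y_budget N hT0
  have hd2 := H.dec₂_pos
  obtain ⟨-, hd2eq⟩ := dec₁Y_eq_Q κ Φ t p D g f mk
  have hP1 := Skelφ.natDiv_le_kgSLY hn1 ℓᵣ hᵣ
  rw [kgSLY_eq_kgSL] at hP1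
  have hP0nat : ((nᵣ * ℓᵣ / Uᵣ : ℕ) : ℤ) = ((nᵣ : ℕ) : ℤ) * ℓᵣ / (Uᵣ : ℕ) := by push_cast; rfl
  have hq := kgqY_qxYQ4 κ Φ t p D g f hN
  have hdS : ((dS nᵣ ℓᵣ hᵣ : ℕ) : ℤ) ≤ 2 := by exact_mod_cast Skelφ.dS_le_two _ _ _
  obtain ⟨-, ha1hi⟩ := a1Y_bounds_3 κ Φ t p D g f mk hKq hN hg hg2 N hNle
  have h80 : 80 ≤ Neg.K κ := by have := Neg.K_eq κ; omega
  have hK80 : (80 : ℤ) ≤ Kᵣ := by exact_mod_cast h80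
  have hRR : ((KS0.R'0N κ Φ (KS.NQ Φ) t p D mk : ℕ) : ℤ) = ((Rᵣ : ℕ) : ℤ) := rfl
  rw [hRR] at hnR' hR1 hs40
  have hR0 : (0 : ℤ) ≤ ((Rᵣ : ℕ) : ℤ) := by linarith
  have hNR : (((N : ℕ) : ℤ) + 1) * ((Rᵣ : ℕ) : ℤ) ≤ (21 * Kᵣ + 3) * ((Rᵣ : ℕ) : ℤ) := mul_le_mul_of_nonneg_right (by linarith) hR0
  have hNd : (((N : ℕ) : ℤ) + 1) * ((dS nᵣ ℓᵣ hᵣ : ℕ) : ℤ) ≤ (((N : ℕ) : ℤ) + 1) * 2 := mul_le_mul_of_nonneg_left hdS (by positivity)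
  have h1 : (((kgM₁Y nᵣ vᵣ Rᵣ 0 WYᵣ N : ℕ) : ℤ) + 1) * ((Rᵣ : ℕ) : ℤ) ≤ 198 * ((Rᵣ : ℕ) : ℤ) := mul_le_mul_of_nonneg_right ha1hi hR0
  have hKR80 : 80 * ((Rᵣ : ℕ) : ℤ) ≤ Kᵣ * ((Rᵣ : ℕ) : ℤ) := mul_le_mul_of_nonneg_right hK80 hR0
  have hKKR : Kᵣ ≤ Kᵣ * ((Rᵣ : ℕ) : ℤ) := le_mul_of_one_le_right (by linarith) hR1
  have hd2' : 4 * ((Rᵣ : ℕ) : ℤ) + 2 ≤ kgDec₂Y nᵣ ℓᵣ hᵣ Rᵣ 0 := by have h := hd2; push_cast at h; linarith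
  -- `T − P < 20·dec₂`
  have hTP : kgTY nᵣ ℓᵣ hᵣ vᵣ Rᵣ 0 qYᵣ WYᵣ N - (((nᵣ : ℕ) : ℤ) * ℓᵣ / (Uᵣ : ℕ) + 1 + ((0 : ℕ) : ℤ) - 1) < 42 * kgDec₂Y nᵣ ℓᵣ hᵣ Rᵣ 0 := by
    rw [hd2eq, ← hP0nat]; unfold Skelφ.kgTY; push_cast; rw [hq]; linarith
  by_contra hcon
  have hcon' : 42 < (((kgM₂Y nᵣ ℓᵣ hᵣ vᵣ Rᵣ 0 qYᵣ WYᵣ N : ℕ) : ℤ) + 1) := not_le.mp hcon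
  have h21 : 43 * kgDec₂Y nᵣ ℓᵣ hᵣ Rᵣ 0 ≤ (((kgM₂Y nᵣ ℓᵣ hᵣ vᵣ Rᵣ 0 qYᵣ WYᵣ N : ℕ) : ℤ) + 1) * kgDec₂Y nᵣ ℓᵣ hᵣ Rᵣ 0 := mul_le_mul_of_nonneg_right (by linarith) (by linarith)
  linarith

/-- **`XY ≤ 22·sL`** (`XY = q + (N+1)R′ + (N+1)dS + (m₁Y+1)R′ + (m₂Y+1)R′`, `q = P + 19sL + 20`). [this work] -/
theorem XY_le_3 (κ : Consts) {V : Type} [DecidableEq V] [Countable V] {G : SimpleGraph V} [G.LocallyFinite] (Φ : PlanarSkeletonFrmQuasi G) (t : V) (p : unitInterval) (D : Skelφ.StepI.DataNS V) (g : ℕ) (f : ℕ) (mk : ℕ) (hKq : 5 ≤ Neg.Kq κ) (hN : EqNumL κ Φ t p D g f) (hg : gFloorKG κ Φ t p D mk ≤ g) (hg2 : 40 * Neg.K κ * KS0.R'0N κ Φ (KS.NQ Φ) t p D mk ≤ g) (N : ℕ)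
    (hNle : ((N : ℕ) : ℤ) ≤ 21 * Kᵣ + 2) :
    0 ≤ kgXY nᵣ ℓᵣ hᵣ vᵣ Rᵣ 0 qYᵣ WYᵣ N ∧ kgXY nᵣ ℓᵣ hᵣ vᵣ Rᵣ 0 qYᵣ WYᵣ N ≤ 22 * sLᵣ := by
  refine ⟨Skelφ.kgXY_nonneg (n := nᵣ) (ℓ := ℓᵣ) (hs := hᵣ) (v := vᵣ) (R' := Rᵣ) (ρ := 0) (q := qYᵣ) (W := WYᵣ) N, ?_⟩
  obtain ⟨hnR', hs40, hbig, hR1, -, -⟩ := valsQ_floor κ Φ t p D g f mk hN hg hg2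
  obtain ⟨hn1, -⟩ := one_le_of_eqNumL κ Φ t p D g f hN
  have hP1 := Skelφ.natDiv_le_kgSLY hn1 ℓᵣ hᵣ
  rw [kgSLY_eq_kgSL] at hP1
  have hq := kgqY_qxYQ4 κ Φ t p D g f hN
  have hdS : ((dS nᵣ ℓᵣ hᵣ : ℕ) : ℤ) ≤ 2 := by exact_mod_cast Skelφ.dS_le_two _ _ _
  obtain ⟨-, ha1hi⟩ := a1Y_bounds_3 κ Φ t p D g f mk hKq hN hg hg2 N hNle
  obtain ⟨-, ha2hi⟩ := a2Y_le_3 κ Φ t p D g f mk hKq hN hg hg2 N hNle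
  have h80 : 80 ≤ Neg.K κ := by have := Neg.K_eq κ; omega
  have hK80 : (80 : ℤ) ≤ Kᵣ := by exact_mod_cast h80
  have hRR : ((KS0.R'0N κ Φ (KS.NQ Φ) t p D mk : ℕ) : ℤ) = ((Rᵣ : ℕ) : ℤ) := rfl
  rw [hRR] at hnR' hR1 hs40
  have hR0 : (0 : ℤ) ≤ ((Rᵣ : ℕ) : ℤ) := by linarith
  have hNR : (((N : ℕ) : ℤ) + 1) * ((Rᵣ : ℕ) : ℤ) ≤ (21 * Kᵣ + 3) * ((Rᵣ : ℕ) : ℤ) := mul_le_mul_of_nonneg_right (by linarith) hR0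
  have hNd : (((N : ℕ) : ℤ) + 1) * ((dS nᵣ ℓᵣ hᵣ : ℕ) : ℤ) ≤ (((N : ℕ) : ℤ) + 1) * 2 := mul_le_mul_of_nonneg_left hdS (by positivity)
  have h1 : (((kgM₁Y nᵣ vᵣ Rᵣ 0 WYᵣ N : ℕ) : ℤ) + 1) * ((Rᵣ : ℕ) : ℤ) ≤ 198 * ((Rᵣ : ℕ) : ℤ) := mul_le_mul_of_nonneg_right ha1hi hR0
  have h2 : (((kgM₂Y nᵣ ℓᵣ hᵣ vᵣ Rᵣ 0 qYᵣ WYᵣ N : ℕ) : ℤ) + 1) * ((Rᵣ : ℕ) : ℤ) ≤ 42 * ((Rᵣ : ℕ) : ℤ) := mul_le_mul_of_nonneg_right ha2hi hR0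
  have hKR80 : 80 * ((Rᵣ : ℕ) : ℤ) ≤ Kᵣ * ((Rᵣ : ℕ) : ℤ) := mul_le_mul_of_nonneg_right hK80 hR0
  have hKKR : Kᵣ ≤ Kᵣ * ((Rᵣ : ℕ) : ℤ) := le_mul_of_one_le_right (by linarith) hR1
  unfold Skelφ.kgXY; push_cast; rw [hq]; linarith

export PlanarSkeletonFrm.NegB (kgCtr2Y_eq_zero)

export PlanarSkeletonFrm.NegB (kgHw2Y_eq_zero)

/-! ## §2 The fine-0 readings, the creep `cRvY3`, the slot `cR2`, the row `hLtY_3` -/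

/-- **THE FINE-0 READINGS OF THE y′-ARRIVAL BOX** (`creepY_core3` at the tuple): width `≤ 152·s₀ − 3`, sum `∈ [0, 251·s₀ + 1]`, `−2K·s₀ ≤ rdLo₀`,
`rdHi₀ ≤ 2K·s₀`, under `2 ≤ Kq` and `hLl_Q`'s floors. [this work] -/
theorem rd0Y_bounds_3 (κ : Consts) {V : Type} [DecidableEq V] [Countable V] {G : SimpleGraph V} [G.LocallyFinite] (Φ : PlanarSkeletonFrmQuasi G) (t : V) (p : unitInterval) (D : Skelφ.StepI.DataNS V) (g : ℕ) (f : ℕ) (mk : ℕ) (hKq : 5 ≤ Neg.Kq κ) (hN : EqNumL κ Φ t p D g f) (hg : gFloorKG κ Φ t p D mk ≤ g) (hg2 : 40 * Neg.K κ * KS0.R'0N κ Φ (KS.NQ Φ) t p D mk ≤ g) :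
    HIᵣ - LOᵣ ≤ 152 * s0ᵣ - 3 ∧ 0 ≤ LOᵣ + HIᵣ ∧ LOᵣ + HIᵣ ≤ 251 * s0ᵣ + 1 ∧ -(2 * Kᵣ * s0ᵣ) ≤ LOᵣ ∧ HIᵣ ≤ 2 * Kᵣ * s0ᵣ := by
  -- the tuple's facts
  obtain ⟨hsc0, -, hn1, hA0, hDp, hm, -, -, hkq, -⟩ := hsc_Q κ Φ t p D g f hN
  obtain ⟨hnR', hs40, hbig, hR1, -, -⟩ := valsQ_floor κ Φ t p D g f mk hN hg hg2
  have hUs := UsL_le_modulus κ Φ t p D g f hN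
  have hNle : ((NYᵣ : ℕ) : ℤ) ≤ 21 * Kᵣ + 2 := by exact_mod_cast kgNYv0_le κ Φ t p D g f mk (qxYQ4 κ Φ t p D g f) (WxYQ4 κ Φ t p D g f) hN hg
  have H := kgYRows0_of κ Φ t p D g f mk (qxYQ4 κ Φ t p D g f) (WxYQ4 κ Φ t p D g f) hN hg
  obtain ⟨-, hE2, hE3⟩ := H.kgE₁Y_spec NYᵣ
  have hv := hN.v_le
  have hd1eq := (dec₁Y_eq_Q κ Φ t p D g f mk).1
  obtain ⟨ha1lo, ha1hi⟩ := a1Y_bounds_3 κ Φ t p D g f mk hKq hN hg hg2 NYᵣ hNle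
  obtain ⟨ha2lo, ha2hi⟩ := a2Y_le_3 κ Φ t p D g f mk hKq hN hg hg2 NYᵣ hNle
  obtain ⟨hXY0, hXYle⟩ := XY_le_3 κ Φ t p D g f mk hKq hN hg hg2 NYᵣ hNle
  have hCeq := kgCtr2Y_eq_zero H NYᵣ
  have hHeq := kgHw2Y_eq_zero nᵣ ℓᵣ hᵣ vᵣ Rᵣ qYᵣ WYᵣ NYᵣ
  have hP0 := kgSL_le_natDiv κ Φ t p D g f hN
  have hP1 := Skelφ.natDiv_le_kgSLY hn1 ℓᵣ hᵣ
  have hP0nat : ((nᵣ * ℓᵣ / Uᵣ : ℕ) : ℤ) = ((nᵣ : ℕ) : ℤ) * ℓᵣ / (Uᵣ : ℕ) := by push_cast; rfl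
  rw [hP0nat] at hP0 hP1
  rw [kgSLY_eq_kgSL] at hP1
  have h80 : 80 ≤ Neg.K κ := by have := Neg.K_eq κ; omega
  have hK80 : (80 : ℤ) ≤ Kᵣ := by exact_mod_cast h80
  have hRR : ((KS0.R'0N κ Φ (KS.NQ Φ) t p D mk : ℕ) : ℤ) = ((Rᵣ : ℕ) : ℤ) := rfl
  rw [hRR] at hnR' hR1 hs40
  have hR0 : (0 : ℤ) ≤ ((Rᵣ : ℕ) : ℤ) := by linarith
  have hn0 : (0 : ℤ) < ((nᵣ : ℕ) : ℤ) := by exact_mod_cast hn1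
  have hn1z : (1 : ℤ) ≤ ((nᵣ : ℕ) : ℤ) := by exact_mod_cast hn1
  have hA1 : 1 ≤ Aof κ := by linarith
  have hs0one : (1 : ℤ) ≤ s0ᵣ := by exact_mod_cast (fcellsA κ Φ t p D g f).hs 0
  have hs0p : (0 : ℤ) < s0ᵣ := by linarith
  -- `Δ ≤ nℓ ≤ U·sL + 2U − 2`, `n ≤ U`
  have hmod := (Skelφ.NegPrm.modulus_vβOf hn1 hᵣ ℓᵣ vᵣ).2
  have hvβ : vβL κ Φ t p D g f = Skelφ.NegPrm.vβOf nᵣ hᵣ ℓᵣ vᵣ := rfl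
  rw [← hvβ] at hmod
  have hU : (0 : ℤ) < (Uᵣ : ℕ) := Skelφ.shearUnit_pos hn1 _
  have hUn : ((nᵣ : ℕ) : ℤ) ≤ (Uᵣ : ℕ) := by rw [shearUnit_cast]; linarith [abs_nonneg hᵣ]
  have hΔU : Δᵣ ≤ ((Uᵣ : ℕ) : ℤ) * sLᵣ + 2 * ((Uᵣ : ℕ) : ℤ) := by
    have hfl := Int.lt_mul_ediv_self_add (x := ((nᵣ : ℕ) : ℤ) * ℓᵣ - (Uᵣ : ℕ) + 1) hU
    unfold Skelφ.kgSL; linarith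
  -- `c₀′·A·Δ = s₀·D`
  have hr0 : r0ᵣ = 40 * ((Neg.Kq κ : ℕ) : ℤ) * s0ᵣ := by
    rw [PCells2.r_eq, show ((fcellsA κ Φ t p D g f).K : ℤ) = Neg.K κ by exact_mod_cast (fcellsA_K κ Φ t p D g f).1,
      show Kᵣ = 40 * ((Neg.Kq κ : ℕ) : ℤ) by exact_mod_cast Neg.K_eq κ]
  have e0 : (prFA κ Φ t p D g f).c₀ * Aof κ * Δᵣ = s0ᵣ * (prFA κ Φ t p D g f).D := by
    rw [hr0] at hsc0
    have h' : (40 * ((Neg.Kq κ : ℕ) : ℤ)) * ((prFA κ Φ t p D g f).c₀ * Aof κ * Δᵣ) = (40 * ((Neg.Kq κ : ℕ) : ℤ)) * (s0ᵣ * (prFA κ Φ t p D g f).D) := by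
      linear_combination hsc0
    have h40 : (40 * ((Neg.Kq κ : ℕ) : ℤ)) ≠ 0 := by positivity
    exact mul_left_cancel₀ h40 h'
  -- the box rows and the `/2` facts
  obtain ⟨elo0, ehi0, elo1, ehi1⟩ := arrY3_apply κ Φ t p D g f mk
  have hbox : kgCtr2Y nᵣ vᵣ Rᵣ 0 WYᵣ NYᵣ - kgHw2Y nᵣ ℓᵣ hᵣ vᵣ Rᵣ 0 qYᵣ WYᵣ NYᵣ ≤ 2 * arrLoY3 κ Φ t p D g f mk 0 ∧ 2 * arrLoY3 κ Φ t p D g f mk 0 ≤ kgCtr2Y nᵣ vᵣ Rᵣ 0 WYᵣ NYᵣ - kgHw2Y nᵣ ℓᵣ hᵣ vᵣ Rᵣ 0 qYᵣ WYᵣ NYᵣ + 1 ∧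
      2 * arrHiY3 κ Φ t p D g f mk 0 ≤ kgCtr2Y nᵣ vᵣ Rᵣ 0 WYᵣ NYᵣ + kgHw2Y nᵣ ℓᵣ hᵣ vᵣ Rᵣ 0 qYᵣ WYᵣ NYᵣ ∧ kgCtr2Y nᵣ vᵣ Rᵣ 0 WYᵣ NYᵣ + kgHw2Y nᵣ ℓᵣ hᵣ vᵣ Rᵣ 0 qYᵣ WYᵣ NYᵣ - 1 ≤ 2 * arrHiY3 κ Φ t p D g f mk 0 := by
    rw [elo0, ehi0]; omega
  have hlo1 : arrLoY3 κ Φ t p D g f mk 1 = (((NYᵣ : ℕ) : ℤ) + 1) * sLᵣ + kgXY nᵣ ℓᵣ hᵣ vᵣ Rᵣ 0 qYᵣ WYᵣ NYᵣ - ((nᵣ : ℕ) : ℤ) * ℓᵣ / (Uᵣ : ℕ) := by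
    rw [elo1, kgSLY_eq_kgSL]; push_cast; ring
  have hT2 : vᵣ * (((Uᵣ : ℕ) : ℤ) * arrHiY3 κ Φ t p D g f mk 1 + ((Uᵣ : ℕ) : ℤ) - 1) = vᵣ * (((Uᵣ : ℕ) : ℤ) * arrLoY3 κ Φ t p D g f mk 1) + vᵣ * (((Uᵣ : ℕ) : ℤ) * (((nᵣ : ℕ) : ℤ) * ℓᵣ / (Uᵣ : ℕ)) + ((Uᵣ : ℕ) : ℤ) - 1) := by
    rw [ehi1, elo1]; push_cast; ring
  -- the readings as nested floors
  rw [Skelφ.rdLo_zero, Skelφ.rdHi_zero]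
  set Zm := (Δᵣ * arrLoY3 κ Φ t p D g f mk 0 - max (vᵣ * (((Uᵣ : ℕ) : ℤ) * arrLoY3 κ Φ t p D g f mk 1)) (vᵣ * (((Uᵣ : ℕ) : ℤ) * arrHiY3 κ Φ t p D g f mk 1 + ((Uᵣ : ℕ) : ℤ) - 1))) with hZm
  set Zp := (Δᵣ * arrHiY3 κ Φ t p D g f mk 0 - min (vᵣ * (((Uᵣ : ℕ) : ℤ) * arrLoY3 κ Φ t p D g f mk 1)) (vᵣ * (((Uᵣ : ℕ) : ℤ) * arrHiY3 κ Φ t p D g f mk 1 + ((Uᵣ : ℕ) : ℤ) - 1))) with hZp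
  have hqm := Int.mul_ediv_self_le (x := Aof κ * Zm) (ne_of_gt hn0)
  have hqm' := Int.lt_mul_ediv_self_add (x := Aof κ * Zm) hn0
  have hqp := Int.mul_ediv_self_le (x := Aof κ * Zp) (ne_of_gt hn0)
  have hqp' := Int.lt_mul_ediv_self_add (x := Aof κ * Zp) hn0
  have hFm := Int.mul_ediv_self_le (x := (prFA κ Φ t p D g f).c₀ * (Aof κ * Zm / ((nᵣ : ℕ) : ℤ))) (ne_of_gt hDp)
  have hFm' := Int.lt_mul_ediv_self_add (x := (prFA κ Φ t p D g f).c₀ * (Aof κ * Zm / ((nᵣ : ℕ) : ℤ))) hDp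
  have hFp := Int.mul_ediv_self_le (x := (prFA κ Φ t p D g f).c₀ * (Aof κ * Zp / ((nᵣ : ℕ) : ℤ))) (ne_of_gt hDp)
  have hFp' := Int.lt_mul_ediv_self_add (x := (prFA κ Φ t p D g f).c₀ * (Aof κ * Zp / ((nᵣ : ℕ) : ℤ))) hDp
  obtain ⟨hF1, hF2⟩ := floorA_bounds hA1 hn0 hm hs0p hDp e0 hqm hqm' hFm hFm'
  obtain ⟨hF3, hF4⟩ := floorA_bounds hA1 hn0 hm hs0p hDp e0 hqp hqp' hFp hFp'
  have hE5 : ((kgE₁Y nᵣ vᵣ Rᵣ 0 WYᵣ NYᵣ : ℕ) : ℤ) ≤ 5 * ((nᵣ : ℕ) : ℤ) := by linarith [abs_nonneg vᵣ]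
  have hK100 : (100 : ℤ) ≤ Kᵣ := by
    have h100 : 100 ≤ Neg.K κ := by have := Neg.K_eq κ; omega
    exact_mod_cast h100
  exact creepY_core3 (hn := hn1z) (hUn := hUn) (hUs := hUs) (hΔU := hΔU) (hs := hbig) (hK := hK100) (hR := hR1) (hKR := hs40) (hnR := hnR')
    (hav0 := abs_nonneg _) (havn := hv) (hv1 := le_abs_self _) (hv2 := neg_le_abs _) (hN0 := Nat.cast_nonneg _) (hN := hNle)
    (ha1 := ha1lo) (ha1' := ha1hi) (ha2 := ha2lo) (ha2' := ha2hi) (hE0 := hE2) (hE1 := hE5) (hXY0 := hXY0) (hXY := hXYle)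
    (hP0 := hP0) (hP1 := hP1) (hH := hHeq) (hC := hCeq) (hlo0 := hbox.1) (hlo0' := hbox.2.1) (hhi0 := hbox.2.2.1) (hhi0' := hbox.2.2.2)
    (hlo1 := hlo1) (hG := rfl) (hT₁ := rfl) (hT₂ := hT2) (hAm := hZm) (hAp := hZp) (hs0 := hs0one) (hF1 := hF1) (hF2 := hF2) (hF3 := hF3) (hF4 := hF4)

/-- **The midpoint of the y′-arrival box's fine-0 reading.** [this work] -/
def cmidY3 (κ : Consts) {V : Type} [DecidableEq V] [Countable V] {G : SimpleGraph V} [G.LocallyFinite] (Φ : PlanarSkeletonFrmQuasi G) (t : V) (p : unitInterval) (D : Skelφ.StepI.DataNS V) (g : ℕ) (f : ℕ) (mk : ℕ) : ℤ := (LOᵣ + HIᵣ) / 2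

/-- **THE y-STEP's x-CREEP OF RECORD** `cRvY3 := cmidY3.toNat` (fine-0 units). [this work] -/
def cRvY3 (κ : Consts) {V : Type} [DecidableEq V] [Countable V] {G : SimpleGraph V} [G.LocallyFinite] (Φ : PlanarSkeletonFrmQuasi G) (t : V) (p : unitInterval) (D : Skelφ.StepI.DataNS V) (g : ℕ) (f : ℕ) (mk : ℕ) : ℕ := (cmidY3 κ Φ t p D g f mk).toNat

/-- `cRvY3 = cmidY3 ≥ 0` as an integer. [folklore] -/
theorem cRvY3_eq (κ : Consts) {V : Type} [DecidableEq V] [Countable V] {G : SimpleGraph V} [G.LocallyFinite] (Φ : PlanarSkeletonFrmQuasi G) (t : V) (p : unitInterval) (D : Skelφ.StepI.DataNS V) (g : ℕ) (f : ℕ) (mk : ℕ) (hKq : 5 ≤ Neg.Kq κ) (hN : EqNumL κ Φ t p D g f) (hg : gFloorKG κ Φ t p D mk ≤ g) (hg2 : 40 * Neg.K κ * KS0.R'0N κ Φ (KS.NQ Φ) t p D mk ≤ g) :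
    ((cRvY3 κ Φ t p D g f mk : ℕ) : ℤ) = cmidY3 κ Φ t p D g f mk ∧ 0 ≤ cmidY3 κ Φ t p D g f mk := by
  obtain ⟨-, hs, -⟩ := rd0Y_bounds_3 κ Φ t p D g f mk hKq hN hg hg2
  have h0 : 0 ≤ cmidY3 κ Φ t p D g f mk := by unfold cmidY3; omega
  exact ⟨by unfold cRvY3; rw [Int.toNat_of_nonneg h0], h0⟩

/-- **THE PROVED CAP** (lead 09:49:01Z): `2·cRvY3 ≤ 251·s₀ + 1` (so `cRvY3 ≤ 126·s₀`), and `cRvY3 ≤ K·s₀ = r 0` once `K ≥ 80`. [this work] -/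
theorem cRvY3_le (κ : Consts) {V : Type} [DecidableEq V] [Countable V] {G : SimpleGraph V} [G.LocallyFinite] (Φ : PlanarSkeletonFrmQuasi G) (t : V) (p : unitInterval) (D : Skelφ.StepI.DataNS V) (g : ℕ) (f : ℕ) (mk : ℕ) (hKq : 5 ≤ Neg.Kq κ) (hN : EqNumL κ Φ t p D g f) (hg : gFloorKG κ Φ t p D mk ≤ g) (hg2 : 40 * Neg.K κ * KS0.R'0N κ Φ (KS.NQ Φ) t p D mk ≤ g) :
    2 * ((cRvY3 κ Φ t p D g f mk : ℕ) : ℤ) ≤ 251 * s0ᵣ + 1 ∧ ((cRvY3 κ Φ t p D g f mk : ℕ) : ℤ) ≤ 126 * s0ᵣ ∧ cRvY3 κ Φ t p D g f mk ≤ (fcellsA κ Φ t p D g f).r 0 := by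
  obtain ⟨-, -, hs, -⟩ := rd0Y_bounds_3 κ Φ t p D g f mk hKq hN hg hg2
  obtain ⟨hc, -⟩ := cRvY3_eq κ Φ t p D g f mk hKq hN hg hg2
  have hs0one : (1 : ℤ) ≤ s0ᵣ := by exact_mod_cast (fcellsA κ Φ t p D g f).hs 0
  have hr0 : r0ᵣ = Kᵣ * s0ᵣ := by
    rw [PCells2.r_eq, show ((fcellsA κ Φ t p D g f).K : ℤ) = Neg.K κ by exact_mod_cast (fcellsA_K κ Φ t p D g f).1]
  have h80 : 80 ≤ Neg.K κ := by have := Neg.K_eq κ; omega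
  have hK80 : (80 : ℤ) ≤ Kᵣ := by exact_mod_cast h80
  have hKC : (200 : ℤ) ≤ Kᵣ := by
    have := Neg.K_eq κ; have h' : 200 ≤ Neg.K κ := by omega
    exact_mod_cast h'
  have hKs : 200 * s0ᵣ ≤ Kᵣ * s0ᵣ := mul_le_mul_of_nonneg_right hKC (by linarith)
  have h2 : 2 * ((cRvY3 κ Φ t p D g f mk : ℕ) : ℤ) ≤ 251 * s0ᵣ + 1 := by
    rw [hc]; unfold cmidY3
    generalize LOᵣ = lo at hs
    generalize HIᵣ = hi at hs
    omega
  refine ⟨h2, by linarith, ?_⟩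
  have key : ((cRvY3 κ Φ t p D g f mk : ℕ) : ℤ) ≤ r0ᵣ := by rw [hr0]; linarith
  exact_mod_cast key

/-- **THE y′-ARRIVAL READING ROW, ACROSS (`hLt` at `du.1 = 1`)**: `cRvY3 − b₀ + 1 ≤ rdLo₀ ∧ rdHi₀ ≤ cRvY3 + b₀ − 1 ∧ −2r₀ ≤ rdLo₀ ∧ rdHi₀ ≤ 2r₀` for the box
`[arrLoY3, arrHiY3]`, the creep of record `cRvY3` and the window of record `b₀ = small 0 = 30·s₀`. [this work] -/
theorem hLtY_3 (κ : Consts) {V : Type} [DecidableEq V] [Countable V] {G : SimpleGraph V} [G.LocallyFinite] (Φ : PlanarSkeletonFrmQuasi G) (t : V) (p : unitInterval) (D : Skelφ.StepI.DataNS V) (g : ℕ) (f : ℕ) (mk : ℕ) (hKq : 5 ≤ Neg.Kq κ) (hN : EqNumL κ Φ t p D g f) (hg : gFloorKG κ Φ t p D mk ≤ g) (hg2 : 40 * Neg.K κ * KS0.R'0N κ Φ (KS.NQ Φ) t p D mk ≤ g) :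
    ((cRvY3 κ Φ t p D g f mk : ℕ) : ℤ) - ((BSlot.small3 κ Φ t p D g f 0 : ℕ) : ℤ) + 1 ≤ LOᵣ ∧ HIᵣ ≤ ((cRvY3 κ Φ t p D g f mk : ℕ) : ℤ) + ((BSlot.small3 κ Φ t p D g f 0 : ℕ) : ℤ) - 1 ∧
      -(2 * r0ᵣ) ≤ LOᵣ ∧ HIᵣ ≤ 2 * r0ᵣ := by
  obtain ⟨hw, hs, hs', hlo, hhi⟩ := rd0Y_bounds_3 κ Φ t p D g f mk hKq hN hg hg2
  obtain ⟨hc, -⟩ := cRvY3_eq κ Φ t p D g f mk hKq hN hg hg2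
  have hr0 : r0ᵣ = Kᵣ * s0ᵣ := by
    rw [PCells2.r_eq, show ((fcellsA κ Φ t p D g f).K : ℤ) = Neg.K κ by exact_mod_cast (fcellsA_K κ Φ t p D g f).1]
  have hb0 : ((BSlot.small3 κ Φ t p D g f 0 : ℕ) : ℤ) = 76 * s0ᵣ := by rw [(small3_eq κ Φ t p D g f).1]; push_cast; ring
  have hKs2 : 2 * Kᵣ * s0ᵣ = 2 * (Kᵣ * s0ᵣ) := by ring
  rw [hKs2] at hlo hhi
  rw [hc, hr0, hb0]
  unfold cmidY3
  generalize LOᵣ = lo at hw hs hs' hlo hhi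
  generalize HIᵣ = hi at hw hs hs' hlo hhi
  generalize Kᵣ * s0ᵣ = Ks at hlo hhi
  generalize s0ᵣ = s0 at hw hs'
  omega

end CreepY

end NegB

end PlanarSkeletonFrmQuasi

end Summit.CriticalPhenomena.PercolationContinuityZ3.Theorems.Transplant

end
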